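import Literature.NumberTheory.LFunctions.HeilbronnCharacter
import Literature.NumberTheory.LFunctions.DedekindZetaERHProofs
import Literature.NumberTheory.LFunctions.ZetaZerosProofs
import Literature.NumberTheory.LFunctions.StarkAtMostOneZeroBridge
import HarnessLib

/-!
# Route `DedekindQuotient1951` (Langlands) — crux `QuinticDedekindPole` (stmt-Langlands-17270),
# line `Sketch`, stub `stub_negativeGlue`

The complex-analytic glue of the FALSE direction of the crux. On the box
`B = {0 < re s, |im s| < 100}` suppose that at every `s₀ ∈ B`, `s₀ ≠ 1`, the meromorphic order of
`ζ` is at most that of the continued Dedekind zeta function `ζ_K^{cont}` (`dedekindZetaCont K`).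
Then some `g` holomorphic on `B` satisfies `g · ζ = ζ_K` on `{1 < re s} ∩ B`.

Construction: `h := ζ_K^{cont} / ζ` is meromorphic on `ℂ` (both factors are; for `ζ` we transfer
meromorphy from `ζ_ℚ^{cont}`, which agrees with `ζ` off `1`), with order
`ord h = ord ζ_K^{cont} − ord ζ ≥ 0` at every point of `B` (off `1` by hypothesis, at `1` both
factors have a simple pole). Its meromorphic normal form `g := toMeromorphicNFOn h B` is therefore
analytic on `B`, and on `{1 < re s} ∩ B`, where `h` is already analytic (`ζ ≠ 0`), `g = h`, so
`g · ζ = ζ_K^{cont} = ζ_K` there.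
-/

set_option linter.dupNamespace false -- project-wide option; `Summit.Langlands.Langlands` is the mandated namespace

noncomputable section

open Complex Filter Set
open scoped Topology

namespace Summit.Langlands.Langlands.Theorems.DedekindQuotient1951

open Literature.NumberTheory.LFunctions Literature.NumberTheory.LFunctions.Heilbronn

/-- `ζ` agrees with `ζ_ℚ^{cont}` on every punctured neighbourhood (they agree off `s = 1`,
`dedekindZetaCont_rat_eq_riemannZeta_holds`). [folklore] -/
theorem negativeGlue_riemannZeta_eventuallyEq (x : ℂ) :
    riemannZeta =ᶠ[𝓝[≠] x] dedekindZetaCont ℚ := by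
  have h1 : ({1}ᶜ : Set ℂ) ∈ 𝓝[≠] x := by
    rcases eq_or_ne x 1 with rfl | hx
    · exact self_mem_nhdsWithin
    · exact mem_nhdsWithin_of_mem_nhds (isOpen_compl_singleton.mem_nhds hx)
  filter_upwards [h1] with z hz
  exact (dedekindZetaCont_rat_eq_riemannZeta_holds hz).symm

/-- `ζ` is meromorphic on `ℂ` (transfer from `ζ_ℚ^{cont}`, `meromorphic_dedekindZetaCont`).
[folklore] -/
theorem negativeGlue_meromorphic_riemannZeta : Meromorphic riemannZeta := fun x =>
  (meromorphic_dedekindZetaCont ℚ x).congr (negativeGlue_riemannZeta_eventuallyEq x).symm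

/-- `ord_x ζ = ord_x ζ_ℚ^{cont}` at every point. [folklore] -/
theorem negativeGlue_meromorphicOrderAt_riemannZeta (x : ℂ) :
    meromorphicOrderAt riemannZeta x = meromorphicOrderAt (dedekindZetaCont ℚ) x :=
  meromorphicOrderAt_congr (negativeGlue_riemannZeta_eventuallyEq x)

/-- **Simple pole of `ζ_M` at `s = 1`**: `ord_1 ζ_M^{cont} = −1`, since
`ζ_M^{cont}(z) = (z − 1)⁻¹ ζ₁_M(z)` off `1` with `ζ₁_M` entire and `ζ₁_M(1) = res_{s=1} ζ_M ≠ 0`.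
[cite: NeukirchANT1999, Ch. VII (5.11)] -/
theorem negativeGlue_meromorphicOrderAt_dedekindZetaCont_one (M : Type*) [Field M]
    [NumberField M] : meromorphicOrderAt (dedekindZetaCont M) 1 = (-1 : ℤ) := by
  rw [meromorphicOrderAt_eq_int_iff (meromorphic_dedekindZetaCont M 1)]
  refine ⟨dedekindZeta₁ M, (dedekindZeta₁_differentiable M).analyticAt 1, ?_, ?_⟩
  · rw [dedekindZeta₁_apply_one]
    exact_mod_cast _root_.NumberField.dedekindZeta_residue_ne_zero M
  · filter_upwards [self_mem_nhdsWithin] with z hz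
    have hz' : z ≠ 1 := hz
    rw [dedekindZeta₁_apply_of_ne_one hz', zpow_neg, zpow_one, smul_eq_mul, ← mul_assoc,
      inv_mul_cancel₀ (sub_ne_zero.2 hz'), one_mul]

/-- In `WithTop ℤ`, `a ≤ b` gives `0 ≤ b − a` (with `x − ⊤ = ⊤ − x = ⊤`). [folklore] -/
theorem negativeGlue_sub_nonneg {a b : WithTop ℤ} (h : a ≤ b) : 0 ≤ b - a := by
  induction a with
  | top => simp
  | coe a =>
    induction b with
    | top => simp
    | coe b =>
      rw [← WithTop.LinearOrderedAddCommGroup.coe_sub, ← WithTop.coe_zero, WithTop.coe_le_coe]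
      exact sub_nonneg.2 (WithTop.coe_le_coe.1 h)

/-- **stub_negativeGlue** (analytic glue of the FALSE direction): if `ord_{s₀} ζ ≤ ord_{s₀} ζ_K^{cont}`
at every point `s₀ ≠ 1` of the box `B = {0 < re s, |im s| < 100}`, then `ζ_K/ζ` is (the restriction
of) a function holomorphic on the whole box: the meromorphic normal form of `ζ_K^{cont}/ζ` on `B`
has order `≥ 0` everywhere on `B` (at `s₀ = 1` both factors have a simple pole), hence is analytic
there, and it agrees with `ζ_K^{cont}/ζ = ζ_K/ζ` on `re s > 1` (`ζ ≠ 0`, `ζ_K^{cont} = ζ_K`).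
[folklore] -/
theorem stub_negativeGlue (K : Type) [Field K] [NumberField K]
    (hord : ∀ s₀ : ℂ, 0 < s₀.re → |s₀.im| < 100 → s₀ ≠ 1 →
      meromorphicOrderAt riemannZeta s₀ ≤ meromorphicOrderAt (dedekindZetaCont K) s₀) :
    ∃ g : ℂ → ℂ, DifferentiableOn ℂ g {s : ℂ | 0 < s.re ∧ |s.im| < 100} ∧
      ∀ s : ℂ, 1 < s.re → |s.im| < 100 → g s * riemannZeta s = NumberField.dedekindZeta K s := by
  set B : Set ℂ := {s : ℂ | 0 < s.re ∧ |s.im| < 100} with hB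
  set h : ℂ → ℂ := dedekindZetaCont K / riemannZeta with hh
  have hmero : MeromorphicOn h B := fun x _ =>
    (meromorphic_dedekindZetaCont K x).div (negativeGlue_meromorphic_riemannZeta x)
  -- the order inequality on all of `B` (at `1` both orders are `-1`)
  have hle : ∀ x ∈ B, meromorphicOrderAt riemannZeta x ≤ meromorphicOrderAt (dedekindZetaCont K) x := by
    intro x hx
    rcases eq_or_ne x 1 with rfl | hx1
    · rw [negativeGlue_meromorphicOrderAt_riemannZeta,
        negativeGlue_meromorphicOrderAt_dedekindZetaCont_one,
        negativeGlue_meromorphicOrderAt_dedekindZetaCont_one]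
    · exact hord x hx.1 hx.2 hx1
  -- hence `h` has non-negative order on `B`
  have hordh : ∀ x ∈ B, 0 ≤ meromorphicOrderAt h x := by
    intro x hx
    rw [hh, meromorphicOrderAt_div (meromorphic_dedekindZetaCont K x)
      (negativeGlue_meromorphic_riemannZeta x)]
    exact negativeGlue_sub_nonneg (hle x hx)
  refine ⟨toMeromorphicNFOn h B, ?_, ?_⟩
  · intro x hx
    have hNF : MeromorphicNFAt (toMeromorphicNFOn h B) x := meromorphicNFOn_toMeromorphicNFOn h B hx
    have h0 : 0 ≤ meromorphicOrderAt (toMeromorphicNFOn h B) x := by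
      rw [meromorphicOrderAt_toMeromorphicNFOn hmero hx]
      exact hordh x hx
    exact (hNF.meromorphicOrderAt_nonneg_iff_analyticAt.1 h0).differentiableAt.differentiableWithinAt
  · intro s hs him
    have hs1 : s ≠ 1 := fun h1 => by rw [h1, one_re] at hs; exact lt_irrefl _ hs
    have hsB : s ∈ B := ⟨zero_lt_one.trans hs, him⟩
    have hζ : riemannZeta s ≠ 0 := riemannZeta_ne_zero_of_one_lt_re hs
    have han : AnalyticAt ℂ h s :=
      (NumberField.analyticAt_dedekindZetaCont hs1).div (analyticOn_riemannZeta s hs1) hζ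
    have hval : toMeromorphicNFOn h B s = h s := by
      rw [toMeromorphicNFOn_eq_toMeromorphicNFAt hmero hsB,
        toMeromorphicNFAt_eq_self.2 han.meromorphicNFAt]
    rw [hval, hh, Pi.div_apply, div_mul_cancel₀ _ hζ, dedekindZetaCont_eq_dedekindZeta_holds hs]

end Summit.Langlands.Langlands.Theorems.DedekindQuotient1951

end
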